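import Summits.Ventures.CertifiedManyBodySolver.Observables.TorusPairLROCeilingTTPrime
import Literature.MathematicalPhysics.QuantumLattice.SourcedTorusGroundStatePairLROFloor
import Literature.MathematicalPhysics.QuantumLattice.DWaveOrderParameterRightDerivativeTTPrime

/-!
# The QUASI-AVERAGE torus pair LRO of the `t–t'` Hubbard model is `(m⋆)²`
# (`h → 0⁺` after `L → ∞`; Sütő / Lieb–Seiringer–Solovej–Yngvason for `d`-wave pairs)

Cell `hubbard-cq` (venture `CertifiedManyBodySolver`; seat hubbard-cq-p6, row p4–p6 «finite-`h` Koma–Tasaki dictionary»;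
transplant DICTIONARY §1 row B2 / §3 C1, lead RULING 134 (1) re-scope). Inputs BY NAME: hubbard-cq-p4's torus CEILING
`eventually_torusDiagonal_le_of_groundStates` (`TorusPairLROCeilingTTPrime.lean`: along unit ground-state vectors of the
pair-sourced tori `A_L(h) = dWaveSourceTorusTT' L t' U μ h`, `∀ ε, ∀ᶠ j, s_{L_j} ≤ (∂⁺E(h)/2)² + ε`, `h ≥ 0`) and torus
FLOOR `eventually_sq_half_leftDeriv_sub_le_torusDiagonal` (`SourcedTorusGroundStatePairLROFloor.lean`:
`(∂⁻E(h)/2)² − ε ≤ s_{L_j}`, `h > 0`), hubbard-cq-p5's right-continuity of the response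
`tendsto_neg_half_rightDeriv_dWaveSourceEnergyDensityTT'_nhdsGT` and `m⋆ = −∂⁺E(0)/2`. Notation:
`s_L(ψ) = torusDiagonal dWaveFormFactor L ψ = L⁻⁴ Re⟨ψ, Δ_d†Δ_d ψ⟩` (the summit's pair-LRO functional),
`E = dWaveSourceEnergyDensityTT' t' U μ` (concave), `m⁺(h) = −∂⁺E(h)/2`, `m⁻(h) = −∂⁻E(h)/2`,
`m⋆ = dWaveOrderParameterTT' t' U μ = m⁺(0)`.

* §1 RESPONSE SQUEEZE at `h ↓ 0`: `dWaveOrderParameterTT'_le_neg_half_leftDeriv` (`m⋆ ≤ m⁻(h)` for `h > 0`: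
  `∂⁻E(h) ≤ slope E 0 h ≤ ∂⁺E(0)`), `neg_half_leftDeriv_le_neg_half_rightDeriv` (`m⁻(h) ≤ m⁺(h)`, three-chord
  inequality in the limit), **`tendsto_neg_half_leftDeriv_nhdsGT_zero`** (`m⁻(h) → m⋆` as `h ↓ 0`, squeezed between the
  constant `m⋆` and `m⁺(h) → m⋆`), the squared forms, and `exists_forall_sq_half_derivs_mem`
  (`(m⋆)² ≤ m⁻(h)² ≤ m⁺(h)² ≤ (m⋆)² + ε` on some `(0, h₀)`).
* §2 **THE ZERO-FIELD ORDER PARAMETER FLOORS THE SOURCED TORUS PAIR LRO AT EVERY `h > 0`**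
  (`eventually_sq_dWaveOrderParameterTT'_sub_le_torusDiagonal`): for EVERY sequence of unit ground-state vectors of
  `A_{L_j}(h)`, `h > 0`, `∀ ε, ∀ᶠ j, (m⋆)² − ε ≤ s_{L_j}`; near `h = 0` the ceiling closes on the same value
  (`exists_forall_eventually_torusDiagonal_le_sq_add`), whence **THE QUASI-AVERAGE IDENTITY**
  `exists_forall_eventually_abs_torusDiagonal_sub_sq_le`: `∀ ε > 0 ∃ h₀ > 0 ∀ h ∈ (0,h₀)`, for every ground-state
  sequence at source `h`, eventually `|s_{L_j} − (m⋆)²| ≤ ε` — `lim_{h→0⁺} lim_{L→∞} s_L(h) = (m⋆)²` UNIFORMLY over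
  ground-state choices: LSSY's (D.18) «BEC in the sense of quasi-averages» for `d`-wave pairs of lattice fermions.
* §3 ITERATED-LIMIT FORMS for a field-indexed family of ground-state sequences `ψ_h` (`h > 0`):
  `tendsto_limsup_torusDiagonal_nhdsGT_zero` and `tendsto_liminf_torusDiagonal_nhdsGT_zero`
  (`limsup_j s_{L_j}(h)`, `liminf_j s_{L_j}(h) → (m⋆)²` as `h → 0⁺`).
* §4 **SSB ⇔ QUASI-AVERAGE PAIR LRO on the torus** (`hasDWaveOrderTT'_iff_exists_torusDiagonal_floor`):
  `HasDWaveOrderTT' t' U μ ↔ ∃ s > 0, ∀ h > 0, ∀` ground-state sequences of `A_·(h)` along `L_j → ∞`, `∀ᶠ j, s ≤ s_{L_j}`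
  (`→`: §2 with `s = (m⋆)²/2`; `←`: p4's ceiling at each `h > 0` on an existing ground-state sequence
  (`exists_unit_groundStateVector_dWaveSourceTorusTT'`) gives `s ≤ m⁺(h)²`, and `m⁺(h) → m⋆`).

READING (census (24)/(44)/(47)): on the TORUS, pair LRO vs. response is settled in the quasi-average order of limits —
`h → 0⁺` AFTER `L → ∞` gives EXACTLY `(m⋆)²` for every ground-state choice, and `m⋆ > 0` iff the sourced torus pair LRO
stays bounded away from `0`; the ONLY open torus question is the other order, `L → ∞` AT `h = 0` (`[U] ∧ [BN7]`; LSSY's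
(D.17) between the two orders is p4's zero-field ceiling `eventually_torusDiagonal_le_sq_dWaveOrderParameterTT'_add`).
HONEST SCOPE / WHAT THIS IS NOT: statements about ground states of the SOURCED Hamiltonian (`h > 0`, symmetry explicitly
broken) and their `h → 0⁺` limit; T5-class dictionary theorems; no number, no instrument, no phase sentence; nothing is
claimed about `m⋆` itself at any `(t',U,μ)`; not a superconductivity verdict. Everything PROVED; no definition, no named
fact; zero compute.

References: A. Sütő, Phys. Rev. Lett. 94 (2005) 080402 [cite: Suto2005]; E. H. Lieb, R. Seiringer, J. P. Solovej,
J. Yngvason, *The Mathematics of the Bose Gas and its Condensation* (2005), Appendix D, (D.15)–(D.18)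
[cite: LiebSeiringerYngvason2005, App. D]; R. B. Griffiths, Phys. Rev. 152 (1966) 240, §II [cite: Griffiths1966, §II];
T. Koma, H. Tasaki, J. Stat. Phys. 76 (1994) 745, §1 [cite: KomaTasaki1994, §1].
-/

noncomputable section

namespace Summit.Ventures.CertifiedManyBodySolver.Observables.TorusPairLROFixedSource

open Matrix Finset Filter Topology Set Literature.MathematicalPhysics.QuantumLattice
open Literature.Probability.LatticeModels HubbardWave0
open Summit.Ventures.CertifiedManyBodySolver.Observables.SourcedTorusAHM
open Summit.Ventures.CertifiedManyBodySolver.Observables.TorusPairLROCeiling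
open scoped ComplexOrder

/-! ### §1 The response squeeze at `h ↓ 0`: `m⋆ ≤ m⁻(h) ≤ m⁺(h) → m⋆` -/

section Squeeze

variable (t' U μ : ℝ)

/-- **`m⋆ ≤ m⁻(h)` for `h > 0`**: `dWaveOrderParameterTT' t' U μ ≤ −∂⁻E(h)/2` — by concavity
`∂⁻E(h) ≤ slope E 0 h ≤ ∂⁺E(0) = −2m⋆`. (Companion of the tree's `dWaveOrderParameterTT'_le_neg_half_rightDeriv`.)
[cite: Griffiths1966, §II] -/
theorem dWaveOrderParameterTT'_le_neg_half_leftDeriv {h : ℝ} (hh : 0 < h) :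
    dWaveOrderParameterTT' t' U μ ≤ -derivWithin (dWaveSourceEnergyDensityTT' t' U μ) (Iio h) h / 2 := by
  have hc := concaveOn_dWaveSourceEnergyDensityTT' t' U μ
  have h1 := hc.le_slope_of_hasDerivWithinAt_Iio (mem_univ 0) (mem_univ h) hh
    (hasDerivWithinAt_Ioi_Iio_dWaveSourceEnergyDensityTT' t' U μ h).2
  have h2 := hc.slope_le_of_hasDerivWithinAt_Ioi (mem_univ 0) (mem_univ h) hh
    (hasDerivWithinAt_Ioi_Iio_dWaveSourceEnergyDensityTT' t' U μ 0).1
  rw [dWaveOrderParameterTT'_eq_neg_half_rightDeriv]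
  linarith

/-- **`m⁻(h) ≤ m⁺(h)`**: `−∂⁻E(h)/2 ≤ −∂⁺E(h)/2` at every real `h`, i.e. `∂⁺E(h) ≤ ∂⁻E(h)` for the concave `E`
(three-chord inequality `slope E h u ≤ slope E s h` for `s < h < u`, in the limits `u ↓ h`, `s ↑ h`).
[cite: Griffiths1966, §II] -/
theorem neg_half_leftDeriv_le_neg_half_rightDeriv (h : ℝ) :
    -derivWithin (dWaveSourceEnergyDensityTT' t' U μ) (Iio h) h / 2 ≤
      -derivWithin (dWaveSourceEnergyDensityTT' t' U μ) (Ioi h) h / 2 := by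
  have hc := concaveOn_dWaveSourceEnergyDensityTT' t' U μ
  have hR := (hasDerivWithinAt_Ioi_Iio_dWaveSourceEnergyDensityTT' t' U μ h).1
  have hL := (hasDerivWithinAt_Ioi_Iio_dWaveSourceEnergyDensityTT' t' U μ h).2
  -- three-chord inequality: for `s < h < u`, `slope E h u ≤ slope E s h`
  have key : ∀ s u : ℝ, s < h → h < u →
      slope (dWaveSourceEnergyDensityTT' t' U μ) h u ≤ slope (dWaveSourceEnergyDensityTT' t' U μ) s h := by
    intro s u hs hu
    rw [slope_def_field, slope_def_field]
    exact hc.slope_anti_adjacent (mem_univ s) (mem_univ u) hs hu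
  -- the right derivative is the limit of `slope E h u`, `u ↓ h`
  have htR : Tendsto (slope (dWaveSourceEnergyDensityTT' t' U μ) h) (𝓝[>] h)
      (𝓝 (derivWithin (dWaveSourceEnergyDensityTT' t' U μ) (Ioi h) h)) := by
    have := hasDerivWithinAt_iff_tendsto_slope.1 hR
    rwa [show Ioi h \ {h} = Ioi h from by simp] at this
  -- the left derivative is the limit of `slope E s h = slope E h s`, `s ↑ h`
  have htL : Tendsto (slope (dWaveSourceEnergyDensityTT' t' U μ) h) (𝓝[<] h)
      (𝓝 (derivWithin (dWaveSourceEnergyDensityTT' t' U μ) (Iio h) h)) := by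
    have := hasDerivWithinAt_iff_tendsto_slope.1 hL
    rwa [show Iio h \ {h} = Iio h from by simp] at this
  -- Step 1: for each `s < h`, `∂⁺E(h) ≤ slope E s h`
  have step1 : ∀ s : ℝ, s < h →
      derivWithin (dWaveSourceEnergyDensityTT' t' U μ) (Ioi h) h ≤ slope (dWaveSourceEnergyDensityTT' t' U μ) s h := by
    intro s hs
    refine le_of_tendsto htR ?_
    filter_upwards [self_mem_nhdsWithin] with u hu
    exact key s u hs hu
  -- Step 2: pass `s ↑ h` (`slope E s h = slope E h s`)
  have step2 : derivWithin (dWaveSourceEnergyDensityTT' t' U μ) (Ioi h) h ≤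
      derivWithin (dWaveSourceEnergyDensityTT' t' U μ) (Iio h) h := by
    refine ge_of_tendsto htL ?_
    filter_upwards [self_mem_nhdsWithin] with s hs
    rw [slope_comm]
    exact step1 s hs
  linarith

/-- **`m⁻(h) → m⋆` as `h ↓ 0`**: `Tendsto (fun h => −∂⁻E(h)/2) (𝓝[>] 0) (𝓝 (dWaveOrderParameterTT' t' U μ))` — squeezed
between the constant `m⋆` (`dWaveOrderParameterTT'_le_neg_half_leftDeriv`) and `m⁺(h) → m⋆` (the tree's right-continuity
`tendsto_neg_half_rightDeriv_dWaveSourceEnergyDensityTT'_nhdsGT`). [cite: Griffiths1966, §II] -/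
theorem tendsto_neg_half_leftDeriv_nhdsGT_zero :
    Tendsto (fun h : ℝ => -derivWithin (dWaveSourceEnergyDensityTT' t' U μ) (Iio h) h / 2) (𝓝[>] 0)
      (𝓝 (dWaveOrderParameterTT' t' U μ)) := by
  refine tendsto_of_tendsto_of_tendsto_of_le_of_le' tendsto_const_nhds
    (tendsto_neg_half_rightDeriv_dWaveSourceEnergyDensityTT'_nhdsGT t' U μ) ?_ ?_
  · filter_upwards [self_mem_nhdsWithin] with h hh
    exact dWaveOrderParameterTT'_le_neg_half_leftDeriv t' U μ hh
  · exact Eventually.of_forall fun h => neg_half_leftDeriv_le_neg_half_rightDeriv t' U μ h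

/-- `m⁻(h)² → (m⋆)²` as `h ↓ 0`. [cite: Griffiths1966, §II] -/
theorem tendsto_sq_half_leftDeriv_nhdsGT_zero :
    Tendsto (fun h : ℝ => (derivWithin (dWaveSourceEnergyDensityTT' t' U μ) (Iio h) h / 2) ^ 2) (𝓝[>] 0)
      (𝓝 (dWaveOrderParameterTT' t' U μ ^ 2)) := by
  have h := (tendsto_neg_half_leftDeriv_nhdsGT_zero t' U μ).pow 2
  refine h.congr fun x => ?_
  ring

/-- `m⁺(h)² → (m⋆)²` as `h ↓ 0`. [cite: Griffiths1966, §II] -/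
theorem tendsto_sq_half_rightDeriv_nhdsGT_zero :
    Tendsto (fun h : ℝ => (derivWithin (dWaveSourceEnergyDensityTT' t' U μ) (Ioi h) h / 2) ^ 2) (𝓝[>] 0)
      (𝓝 (dWaveOrderParameterTT' t' U μ ^ 2)) := by
  have h := (tendsto_neg_half_rightDeriv_dWaveSourceEnergyDensityTT'_nhdsGT t' U μ).pow 2
  refine h.congr fun x => ?_
  ring

/-- **Near `h = 0` both squared responses are pinned to `(m⋆)²`**: for `ε > 0` there is `h₀ > 0` with
`(m⋆)² ≤ (∂⁻E(h)/2)² ≤ (∂⁺E(h)/2)² ≤ (m⋆)² + ε` for all `0 < h < h₀`. [cite: Griffiths1966, §II] -/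
theorem exists_forall_sq_half_derivs_mem {ε : ℝ} (hε : 0 < ε) :
    ∃ h₀ : ℝ, 0 < h₀ ∧ ∀ h : ℝ, 0 < h → h < h₀ →
      dWaveOrderParameterTT' t' U μ ^ 2 ≤ (derivWithin (dWaveSourceEnergyDensityTT' t' U μ) (Iio h) h / 2) ^ 2 ∧
      (derivWithin (dWaveSourceEnergyDensityTT' t' U μ) (Iio h) h / 2) ^ 2 ≤
        (derivWithin (dWaveSourceEnergyDensityTT' t' U μ) (Ioi h) h / 2) ^ 2 ∧
      (derivWithin (dWaveSourceEnergyDensityTT' t' U μ) (Ioi h) h / 2) ^ 2 ≤ dWaveOrderParameterTT' t' U μ ^ 2 + ε := by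
  obtain ⟨u, hu0, hu⟩ := exists_sq_half_rightDeriv_le_add t' U μ 0 (ε := ε) hε
  have hsq0 : (derivWithin (dWaveSourceEnergyDensityTT' t' U μ) (Ioi 0) 0 / 2) ^ 2 =
      dWaveOrderParameterTT' t' U μ ^ 2 := by
    rw [dWaveOrderParameterTT'_eq_neg_half_rightDeriv]; ring
  refine ⟨u, hu0, fun h hh hhu => ⟨?_, ?_, ?_⟩⟩
  · have hm := dWaveOrderParameterTT'_le_neg_half_leftDeriv t' U μ hh
    have hm0 := dWaveOrderParameterTT'_nonneg t' U μ
    calc dWaveOrderParameterTT' t' U μ ^ 2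
        ≤ (-derivWithin (dWaveSourceEnergyDensityTT' t' U μ) (Iio h) h / 2) ^ 2 := pow_le_pow_left₀ hm0 hm 2
      _ = _ := by ring
  · have h1 := neg_half_leftDeriv_le_neg_half_rightDeriv t' U μ h
    have h0 : 0 ≤ -derivWithin (dWaveSourceEnergyDensityTT' t' U μ) (Iio h) h / 2 :=
      (dWaveOrderParameterTT'_nonneg t' U μ).trans (dWaveOrderParameterTT'_le_neg_half_leftDeriv t' U μ hh)
    calc (derivWithin (dWaveSourceEnergyDensityTT' t' U μ) (Iio h) h / 2) ^ 2
        = (-derivWithin (dWaveSourceEnergyDensityTT' t' U μ) (Iio h) h / 2) ^ 2 := by ring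
      _ ≤ (-derivWithin (dWaveSourceEnergyDensityTT' t' U μ) (Ioi h) h / 2) ^ 2 := pow_le_pow_left₀ h0 h1 2
      _ = _ := by ring
  · have := hu h hh.le (by linarith)
    rwa [hsq0] at this

end Squeeze

/-! ### §2 The quasi-average identity -/

section QuasiAverage

variable {ψ : ∀ L, Fock (Orb (FermionTorus 2 L))} {Ls : ℕ → ℕ} [∀ j, NeZero (Ls j)] {t' U μ h : ℝ}

/-- **THE ZERO-FIELD ORDER PARAMETER FLOORS THE SOURCED TORUS PAIR LRO AT EVERY POSITIVE FIELD**: for unit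
ground-state vectors `ψ_{L_j}` of `A_{L_j}(t',U,μ,h)`, `h > 0`, along `L_j → ∞` and every `ε > 0`, eventually
`(dWaveOrderParameterTT' t' U μ)² − ε ≤ L_j⁻⁴ Re⟨ψ_{L_j}, Δ_d†Δ_d ψ_{L_j}⟩` (p4's floor `(∂⁻E(h)/2)² − ε` and `m⋆ ≤ m⁻(h)`).
[cite: KomaTasaki1994, §1] [cite: Griffiths1966, §II] -/
theorem eventually_sq_dWaveOrderParameterTT'_sub_le_torusDiagonal (hLs : Tendsto Ls atTop atTop) (hh : 0 < h)
    (hunit : ∀ j, star (ψ (Ls j)) ⬝ᵥ ψ (Ls j) = 1)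
    (hgs : ∀ j, dWaveSourceTorusTT' (Ls j) t' U μ h *ᵥ ψ (Ls j) =
      (((dWaveSourceTorusTT' (Ls j) t' U μ h).groundEnergy : ℝ) : ℂ) • ψ (Ls j))
    {ε : ℝ} (hε : 0 < ε) :
    ∀ᶠ j in atTop, dWaveOrderParameterTT' t' U μ ^ 2 - ε ≤ torusDiagonal dWaveFormFactor (Ls j) (ψ (Ls j)) := by
  have hm := dWaveOrderParameterTT'_le_neg_half_leftDeriv t' U μ hh
  have hm0 := dWaveOrderParameterTT'_nonneg t' U μ
  have hsq : dWaveOrderParameterTT' t' U μ ^ 2 ≤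
      (derivWithin (dWaveSourceEnergyDensityTT' t' U μ) (Iio h) h / 2) ^ 2 := by
    calc dWaveOrderParameterTT' t' U μ ^ 2
        ≤ (-derivWithin (dWaveSourceEnergyDensityTT' t' U μ) (Iio h) h / 2) ^ 2 := pow_le_pow_left₀ hm0 hm 2
      _ = _ := by ring
  filter_upwards [eventually_sq_half_leftDeriv_sub_le_torusDiagonal hLs hh hunit hgs hε] with j hj
  linarith

/-- **Near `h = 0` the ceiling closes on `(m⋆)²`**: for `ε > 0` there is `h₀ > 0` such that for every `0 ≤ h < h₀` and
every sequence of unit ground-state vectors of `A_{L_j}(t',U,μ,h)`, eventually `s_{L_j} ≤ (m⋆)² + ε` (p4's ceiling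
`(∂⁺E(h)/2)² + ε/2` and the right-continuity of `∂⁺E` at `0`). [cite: KomaTasaki1993, Theorem 7.3] -/
theorem exists_forall_eventually_torusDiagonal_le_sq_add (t' U μ : ℝ) {ε : ℝ} (hε : 0 < ε) :
    ∃ h₀ : ℝ, 0 < h₀ ∧ ∀ h : ℝ, 0 ≤ h → h < h₀ →
      ∀ {ψ : ∀ L, Fock (Orb (FermionTorus 2 L))} {Ls : ℕ → ℕ} [∀ j, NeZero (Ls j)],
        Tendsto Ls atTop atTop → (∀ j, star (ψ (Ls j)) ⬝ᵥ ψ (Ls j) = 1) →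
        (∀ j, dWaveSourceTorusTT' (Ls j) t' U μ h *ᵥ ψ (Ls j) =
          (((dWaveSourceTorusTT' (Ls j) t' U μ h).groundEnergy : ℝ) : ℂ) • ψ (Ls j)) →
        ∀ᶠ j in atTop, torusDiagonal dWaveFormFactor (Ls j) (ψ (Ls j)) ≤ dWaveOrderParameterTT' t' U μ ^ 2 + ε := by
  obtain ⟨u, hu0, hu⟩ := exists_sq_half_rightDeriv_le_add t' U μ 0 (ε := ε / 2) (by positivity)
  have hsq0 : (derivWithin (dWaveSourceEnergyDensityTT' t' U μ) (Ioi 0) 0 / 2) ^ 2 =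
      dWaveOrderParameterTT' t' U μ ^ 2 := by
    rw [dWaveOrderParameterTT'_eq_neg_half_rightDeriv]; ring
  refine ⟨u, hu0, fun h hh hhu ψ Ls _ hLs hunit hgs => ?_⟩
  have hceil := hu h hh (by linarith)
  rw [hsq0] at hceil
  filter_upwards [eventually_torusDiagonal_le_of_groundStates hLs hh hunit hgs (half_pos hε)] with j hj
  linarith

/-- **THE QUASI-AVERAGE TORUS PAIR LRO IS `(m⋆)²`** (LSSY (D.18) / Sütő for `d`-wave pairs of the `t–t'` Hubbard model
on the torus, every `t'`): for every `ε > 0` there is `h₀ > 0` such that for every source `0 < h < h₀` and EVERY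
sequence of unit ground-state vectors `ψ_{L_j}` of `A_{L_j}(t',U,μ,h)` along `L_j → ∞`, eventually
`|L_j⁻⁴ Re⟨ψ_{L_j}, Δ_d†Δ_d ψ_{L_j}⟩ − (dWaveOrderParameterTT' t' U μ)²| ≤ ε`: `lim_{h→0⁺} lim_{L→∞}` of the sourced torus
pair LRO equals the squared Koma–Tasaki order parameter, uniformly over ground-state choices. The other order of limits
(`L → ∞` at `h = 0`) is the open `[U] ∧ [BN7]` converse. [cite: LiebSeiringerYngvason2005, App. D] [cite: Suto2005] -/
theorem exists_forall_eventually_abs_torusDiagonal_sub_sq_le (t' U μ : ℝ) {ε : ℝ} (hε : 0 < ε) :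
    ∃ h₀ : ℝ, 0 < h₀ ∧ ∀ h : ℝ, 0 < h → h < h₀ →
      ∀ {ψ : ∀ L, Fock (Orb (FermionTorus 2 L))} {Ls : ℕ → ℕ} [∀ j, NeZero (Ls j)],
        Tendsto Ls atTop atTop → (∀ j, star (ψ (Ls j)) ⬝ᵥ ψ (Ls j) = 1) →
        (∀ j, dWaveSourceTorusTT' (Ls j) t' U μ h *ᵥ ψ (Ls j) =
          (((dWaveSourceTorusTT' (Ls j) t' U μ h).groundEnergy : ℝ) : ℂ) • ψ (Ls j)) →
        ∀ᶠ j in atTop, |torusDiagonal dWaveFormFactor (Ls j) (ψ (Ls j)) - dWaveOrderParameterTT' t' U μ ^ 2| ≤ ε := by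
  obtain ⟨h₀, hh₀, H⟩ := exists_forall_eventually_torusDiagonal_le_sq_add t' U μ hε
  refine ⟨h₀, hh₀, fun h hh hhu ψ Ls _ hLs hunit hgs => ?_⟩
  filter_upwards [H h hh.le hhu hLs hunit hgs,
    eventually_sq_dWaveOrderParameterTT'_sub_le_torusDiagonal hLs hh hunit hgs hε] with j h1 h2
  rw [abs_le]
  constructor <;> linarith

end QuasiAverage

/-! ### §3 Iterated-limit forms for a field-indexed family of ground-state sequences -/

section Iterated

variable {Ls : ℕ → ℕ} [∀ j, NeZero (Ls j)] {t' U μ : ℝ}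
  {ψ : ℝ → ∀ L, Fock (Orb (FermionTorus 2 L))}

/-- Along unit vectors the torus diagonal is a bounded real sequence (`0 ≤ s_L ≤ K_d²`). [cite: KLS1988PRL, p. 2582] -/
theorem isBoundedUnder_torusDiagonal (φ : ∀ L, Fock (Orb (FermionTorus 2 L)))
    (hunit : ∀ j, star (φ (Ls j)) ⬝ᵥ φ (Ls j) = 1) :
    IsBoundedUnder (· ≤ ·) atTop (fun j => torusDiagonal dWaveFormFactor (Ls j) (φ (Ls j))) ∧
      IsBoundedUnder (· ≥ ·) atTop (fun j => torusDiagonal dWaveFormFactor (Ls j) (φ (Ls j))) :=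
  ⟨isBoundedUnder_of ⟨(2 * ∑ e ∈ insert (0 : Site 2) unitSteps, |dWaveFormFactor e / Real.sqrt 2|) ^ 2,
      fun j => torusDiagonal_le_of_unit dWaveFormFactor (Ls j) (hunit j)⟩,
    isBoundedUnder_of ⟨0, fun j => torusDiagonal_nonneg dWaveFormFactor (Ls j) (φ (Ls j))⟩⟩

/-- **`limsup_j s_{L_j}(h) → (m⋆)²` as `h → 0⁺`**, for any family `h ↦ (ψ_h(L))_L` of unit ground-state vectors of the
sourced tori `A_L(t',U,μ,h)` (`h > 0`) along a fixed `L_j → ∞`. [cite: LiebSeiringerYngvason2005, App. D] -/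
theorem tendsto_limsup_torusDiagonal_nhdsGT_zero (hLs : Tendsto Ls atTop atTop)
    (hunit : ∀ h : ℝ, 0 < h → ∀ j, star (ψ h (Ls j)) ⬝ᵥ ψ h (Ls j) = 1)
    (hgs : ∀ h : ℝ, 0 < h → ∀ j, dWaveSourceTorusTT' (Ls j) t' U μ h *ᵥ ψ h (Ls j) =
      (((dWaveSourceTorusTT' (Ls j) t' U μ h).groundEnergy : ℝ) : ℂ) • ψ h (Ls j)) :
    Tendsto (fun h : ℝ => limsup (fun j => torusDiagonal dWaveFormFactor (Ls j) (ψ h (Ls j))) atTop) (𝓝[>] 0)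
      (𝓝 (dWaveOrderParameterTT' t' U μ ^ 2)) := by
  rw [Metric.tendsto_nhds]
  intro ε hε
  obtain ⟨h₀, hh₀, H⟩ := exists_forall_eventually_abs_torusDiagonal_sub_sq_le t' U μ (ε := ε / 2) (by positivity)
  have hmem : Ioo (0 : ℝ) h₀ ∈ 𝓝[>] (0 : ℝ) := Ioo_mem_nhdsGT hh₀
  filter_upwards [hmem] with h hh
  have hev := H h hh.1 hh.2 hLs (hunit h hh.1) (hgs h hh.1)
  obtain ⟨hb1, hb2⟩ := isBoundedUnder_torusDiagonal (Ls := Ls) (ψ h) (hunit h hh.1)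
  have hup : limsup (fun j => torusDiagonal dWaveFormFactor (Ls j) (ψ h (Ls j))) atTop ≤
      dWaveOrderParameterTT' t' U μ ^ 2 + ε / 2 := by
    refine limsup_le_of_le hb2.isCoboundedUnder_le ?_
    filter_upwards [hev] with j hj
    rw [abs_le] at hj
    linarith
  have hlo : dWaveOrderParameterTT' t' U μ ^ 2 - ε / 2 ≤
      limsup (fun j => torusDiagonal dWaveFormFactor (Ls j) (ψ h (Ls j))) atTop := by
    refine le_limsup_of_frequently_le ?_ hb1
    refine Eventually.frequently ?_
    filter_upwards [hev] with j hj
    rw [abs_le] at hj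
    linarith
  rw [Real.dist_eq, abs_lt]
  constructor <;> linarith

/-- **`liminf_j s_{L_j}(h) → (m⋆)²` as `h → 0⁺`** (same setting). [cite: LiebSeiringerYngvason2005, App. D] -/
theorem tendsto_liminf_torusDiagonal_nhdsGT_zero (hLs : Tendsto Ls atTop atTop)
    (hunit : ∀ h : ℝ, 0 < h → ∀ j, star (ψ h (Ls j)) ⬝ᵥ ψ h (Ls j) = 1)
    (hgs : ∀ h : ℝ, 0 < h → ∀ j, dWaveSourceTorusTT' (Ls j) t' U μ h *ᵥ ψ h (Ls j) =
      (((dWaveSourceTorusTT' (Ls j) t' U μ h).groundEnergy : ℝ) : ℂ) • ψ h (Ls j)) :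
    Tendsto (fun h : ℝ => liminf (fun j => torusDiagonal dWaveFormFactor (Ls j) (ψ h (Ls j))) atTop) (𝓝[>] 0)
      (𝓝 (dWaveOrderParameterTT' t' U μ ^ 2)) := by
  rw [Metric.tendsto_nhds]
  intro ε hε
  obtain ⟨h₀, hh₀, H⟩ := exists_forall_eventually_abs_torusDiagonal_sub_sq_le t' U μ (ε := ε / 2) (by positivity)
  have hmem : Ioo (0 : ℝ) h₀ ∈ 𝓝[>] (0 : ℝ) := Ioo_mem_nhdsGT hh₀
  filter_upwards [hmem] with h hh
  have hev := H h hh.1 hh.2 hLs (hunit h hh.1) (hgs h hh.1)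
  obtain ⟨hb1, hb2⟩ := isBoundedUnder_torusDiagonal (Ls := Ls) (ψ h) (hunit h hh.1)
  have hup : liminf (fun j => torusDiagonal dWaveFormFactor (Ls j) (ψ h (Ls j))) atTop ≤
      dWaveOrderParameterTT' t' U μ ^ 2 + ε / 2 := by
    refine liminf_le_of_frequently_le ?_ hb2
    refine Eventually.frequently ?_
    filter_upwards [hev] with j hj
    rw [abs_le] at hj
    linarith
  have hlo : dWaveOrderParameterTT' t' U μ ^ 2 - ε / 2 ≤
      liminf (fun j => torusDiagonal dWaveFormFactor (Ls j) (ψ h (Ls j))) atTop := by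
    refine le_liminf_of_le hb1.isCoboundedUnder_ge ?_
    filter_upwards [hev] with j hj
    rw [abs_le] at hj
    linarith
  rw [Real.dist_eq, abs_lt]
  constructor <;> linarith

end Iterated

/-! ### §4 `HasDWaveOrderTT'` ⇔ a positive quasi-average torus pair LRO -/

section Iff

/-- A sequence of unit ground-state vectors of the sourced tori along `L = j + 1` exists (Hermitian matrices on a
nonempty finite index type have ground states), packaged as a family over all `L`. [cite: Tasaki2020, §2.1] -/
theorem exists_groundStateFamily_succ (t' U μ h : ℝ) :
    ∃ φ : ∀ L, Fock (Orb (FermionTorus 2 L)),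
      (∀ j : ℕ, star (φ (j + 1)) ⬝ᵥ φ (j + 1) = 1) ∧
      ∀ j : ℕ, dWaveSourceTorusTT' (j + 1) t' U μ h *ᵥ φ (j + 1) =
        (((dWaveSourceTorusTT' (j + 1) t' U μ h).groundEnergy : ℝ) : ℂ) • φ (j + 1) := by
  have hex : ∀ L : ℕ, ∃ v : Fock (Orb (FermionTorus 2 (L + 1))),
      dWaveSourceTorusTT' (L + 1) t' U μ h *ᵥ v =
          ((Matrix.groundEnergy (dWaveSourceTorusTT' (L + 1) t' U μ h) : ℝ) : ℂ) • v ∧ star v ⬝ᵥ v = 1 :=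
    fun L => exists_unit_groundStateVector_dWaveSourceTorusTT' (L + 1) t' U μ h
  choose v hv using hex
  refine ⟨fun L => Nat.rec (motive := fun L => Fock (Orb (FermionTorus 2 L))) 0 (fun j _ => v j) L,
    fun j => (hv j).2, fun j => (hv j).1⟩

/-- **SPONTANEOUS `d`-WAVE ORDER ⇔ QUASI-AVERAGE TORUS PAIR LRO** (LSSY's «SSB ⇔ BEC in the sense of quasi-averages»,
(D.15)/(D.18), for `d`-wave pairs of the `t–t'` Hubbard model, every `t'`): `HasDWaveOrderTT' t' U μ` (`m⋆ > 0`) holds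
iff there is `s > 0` such that at EVERY source `h > 0`, EVERY sequence of unit ground-state vectors of the sourced tori
`A_{L_j}(t',U,μ,h)` along `L_j → ∞` has torus pair LRO eventually `≥ s`. (`→`: §2 with `s = (m⋆)²/2`; `←`: at each
`h > 0` a ground-state sequence exists, p4's ceiling gives `s ≤ m⁺(h)²`, and `m⁺(h) → m⋆` as `h ↓ 0`.)
[cite: LiebSeiringerYngvason2005, App. D] [cite: Suto2005] [cite: KomaTasaki1994, §1] -/
theorem hasDWaveOrderTT'_iff_exists_torusDiagonal_floor (t' U μ : ℝ) :
    HasDWaveOrderTT' t' U μ ↔ ∃ s : ℝ, 0 < s ∧ ∀ h : ℝ, 0 < h →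
      ∀ {ψ : ∀ L, Fock (Orb (FermionTorus 2 L))} {Ls : ℕ → ℕ} [∀ j, NeZero (Ls j)],
        Tendsto Ls atTop atTop → (∀ j, star (ψ (Ls j)) ⬝ᵥ ψ (Ls j) = 1) →
        (∀ j, dWaveSourceTorusTT' (Ls j) t' U μ h *ᵥ ψ (Ls j) =
          (((dWaveSourceTorusTT' (Ls j) t' U μ h).groundEnergy : ℝ) : ℂ) • ψ (Ls j)) →
        ∀ᶠ j in atTop, s ≤ torusDiagonal dWaveFormFactor (Ls j) (ψ (Ls j)) := by
  constructor
  · intro hm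
    have hm' : 0 < dWaveOrderParameterTT' t' U μ := hm
    refine ⟨dWaveOrderParameterTT' t' U μ ^ 2 / 2, by positivity, fun h hh ψ Ls _ hLs hunit hgs => ?_⟩
    filter_upwards [eventually_sq_dWaveOrderParameterTT'_sub_le_torusDiagonal hLs hh hunit hgs
      (ε := dWaveOrderParameterTT' t' U μ ^ 2 / 2) (by positivity)] with j hj
    linarith
  · rintro ⟨s, hs, H⟩
    -- at every `h > 0`: `s ≤ (∂⁺E(h)/2)²`, from the ceiling along an existing ground-state sequence `L = j + 1`
    have hle : ∀ h : ℝ, 0 < h → s ≤ (derivWithin (dWaveSourceEnergyDensityTT' t' U μ) (Ioi h) h / 2) ^ 2 := by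
      intro h hh
      obtain ⟨φ, hunit, hgs⟩ := exists_groundStateFamily_succ t' U μ h
      haveI : ∀ j : ℕ, NeZero ((fun j : ℕ => j + 1) j) := fun j => ⟨Nat.succ_ne_zero j⟩
      have hLs : Tendsto (fun j : ℕ => j + 1) atTop atTop := tendsto_add_atTop_nat 1
      refine le_of_not_gt fun hlt => ?_
      have hε : 0 < (s - (derivWithin (dWaveSourceEnergyDensityTT' t' U μ) (Ioi h) h / 2) ^ 2) / 2 := by linarith
      have h1 := H h hh (ψ := φ) (Ls := fun j => j + 1) hLs hunit hgs
      have h2 := eventually_torusDiagonal_le_of_groundStates (ψ := φ) (Ls := fun j => j + 1) hLs hh.le hunit hgs hε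
      obtain ⟨j, hj1, hj2⟩ := (h1.and h2).exists
      linarith
    -- pass `h ↓ 0`: `(∂⁺E(h)/2)² → (m⋆)²`
    have hsm : s ≤ dWaveOrderParameterTT' t' U μ ^ 2 := by
      refine ge_of_tendsto (tendsto_sq_half_rightDeriv_nhdsGT_zero t' U μ) ?_
      filter_upwards [self_mem_nhdsWithin] with h hh
      exact hle h hh
    have hm0 := dWaveOrderParameterTT'_nonneg t' U μ
    change 0 < dWaveOrderParameterTT' t' U μ
    rcases hm0.eq_or_lt with heq | hpos
    · rw [← heq] at hsm
      norm_num at hsm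
      linarith
    · exact hpos

end Iff

end Summit.Ventures.CertifiedManyBodySolver.Observables.TorusPairLROFixedSource

end
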